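import Summits.ResolutionOfSingularities.ResolutionOfSingularities.Theorems.EquisingularLiftEquisingularLiftNatNDChartBlowup
import Summits.ResolutionOfSingularities.ResolutionOfSingularities.Theorems.EquisingularLiftEquisingularLiftNatNDChartPlays
import Literature.AlgebraicGeometry.Resolution.CoordinateBlowupChart
import Summits.ResolutionOfSingularities.ResolutionOfSingularities.Theorems.EquisingularLiftEquisingularLiftNatNDStrataTower
import HarnessLib

/-!
# [OURS · L1 W4.5(b) · EL♮(3) · ND-K5 (B4α1)] THE POINT-CHART MATRICES OF `Bl_0 𝔸^{m+1}`

WIDTH helper for the ND-K5 brick (B4α1i) `modelInit` (res-L1-w45b-idea-1's spec §13.14 `ND.ToricStage` / `ND.ModelInit`, port `…NatNDRoundModelSplit`),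
`--supports stmt-ResolutionOfSingularities-20148`, no claim, counted 0 (res-L1-w45b-stub-4 g11).  AI-produced kernel work weaker than expert review; no
statement of [Hironaka2017] is used; EL♮(3) is NOT proved here.

WHAT.  The exponent matrix `pointChartMat m j` of the `j`-th standard chart of the blow-up of the origin of `𝔸^{m+1}_k` (row `j` = `𝟙`, row `i ≠ j` =
`e i`): its toric chart hom `t_l ↦ ∏ᵢ y_i ^ {B i l}` IS the Literature coordinate blow-up substitution `coordBlowupSubst k univ j`
(`toricChartHom_pointChartMat`); its rows as rays (`rayOf_pointChartMat_self/_of_ne`); `det = 1` by the matrix determinant lemma (`det_zMat_pointChartMat`,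
`isUnit_det_zMat_pointChartMat`); its cone `pointCone m j = {𝟙} ∪ {e i | i ≠ j}` (`pointCone_eq`), `Σ frame = 𝟙` (`sum_frame_eq_one`), and the cones of the
point-star `star (orthantFan (m+1)) frame` are EXACTLY the `pointCone m j` (`pointCone_mem_star`, `exists_pointCone_of_mem_star`), all smooth
(`isSmoothCone_of_mem_star_orthant`) — the (TS0)/(TS1) combinatorics of `ND.ModelInit`.
-/

set_option linter.dupNamespace false

noncomputable section

open MvPolynomial

namespace Summit.ResolutionOfSingularities.ResolutionOfSingularities.Cruxes.EquisingularLiftNat.Sections.ND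

variable (m : ℕ) (k : Type) [Field k]

/-- The exponent matrix of the `j`-th chart of the point blow-up of `𝔸^{m+1}`: row `j` is `𝟙` (the exceptional variable divides every `t_l`),
row `i ≠ j` is `e i` (`t_l ↦ y_j · y_l`, `t_j ↦ y_j`). [OURS · model object] -/
def pointChartMat (j : Fin (m + 1)) : Fin (m + 1) → Fin (m + 1) → ℕ :=
  fun i l => if i = j then 1 else if i = l then 1 else 0

/-- The toric chart hom of `pointChartMat j` is the coordinate blow-up substitution of the full frame at `j` (`t_j ↦ y_j`, `t_l ↦ y_j y_l`):
`toricChartHom (m+1) k (pointChartMat m j) = coordBlowupSubst k univ j`. [OURS · elementary] -/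
theorem toricChartHom_pointChartMat (j : Fin (m + 1)) :
    (aeval fun l => ∏ i, (X i : MvPolynomial (Fin (m + 1)) k) ^ pointChartMat m j i l).toRingHom =
      (Literature.AlgebraicGeometry.Resolution.coordBlowupSubst k (Set.univ : Set (Fin (m + 1))) j).toRingHom := by
  refine MvPolynomial.ringHom_ext (fun c => by simp) fun l => ?_
  change aeval _ (X l) = Literature.AlgebraicGeometry.Resolution.coordBlowupSubst k Set.univ j (X l)
  rw [aeval_X, Literature.AlgebraicGeometry.Resolution.coordBlowupSubst_X]
  by_cases hl : l = j
  · subst hl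
    rw [if_neg (fun h => h.2 rfl), Finset.prod_eq_single l]
    · simp [pointChartMat]
    · intro i _ hi
      simp [pointChartMat, hi]
    · intro h; exact absurd (Finset.mem_univ l) h
  · rw [if_pos ⟨Set.mem_univ _, hl⟩, ← Finset.mul_prod_erase Finset.univ _ (Finset.mem_univ j), Finset.prod_eq_single l]
    · simp [pointChartMat, hl]
    · intro i hi hil
      have hij : i ≠ j := (Finset.mem_erase.mp hi).1
      simp [pointChartMat, hij, hil]
    · intro h; exact absurd (Finset.mem_erase.mpr ⟨hl, Finset.mem_univ l⟩) h

/-- The rows of the point-chart matrix: row `j` is the ray `𝟙`. [OURS · elementary] -/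
theorem rayOf_pointChartMat_self (j : Fin (m + 1)) : rayOf (pointChartMat m j j) = 1 := by
  funext l; simp [rayOf, pointChartMat]

/-- The rows of the point-chart matrix: row `i ≠ j` is the frame ray `e i`. [OURS · elementary] -/
theorem rayOf_pointChartMat_of_ne {j i : Fin (m + 1)} (h : i ≠ j) : rayOf (pointChartMat m j i) = e (m + 1) i := by
  funext l
  by_cases hil : i = l
  · subst hil; simp [rayOf, pointChartMat, h, e]
  · simp [rayOf, pointChartMat, h, hil, e, Ne.symm hil]

/-- The point-chart matrix is `1 + e_j · (𝟙 − e_j)ᵀ`, so its determinant is `1 + (𝟙 − e_j) · e_j = 1` (matrix determinant lemma). [OURS · elementary] -/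
theorem det_zMat_pointChartMat (j : Fin (m + 1)) : (zMat (pointChartMat m j)).det = 1 := by
  classical
  have hM : zMat (pointChartMat m j) =
      1 + Matrix.vecMulVec (Pi.single j (1 : ℤ)) (fun l => if l = j then (0 : ℤ) else 1) := by
    ext i l
    simp only [zMat, pointChartMat, Matrix.of_apply, Matrix.add_apply, Matrix.vecMulVec_apply, Pi.single_apply]
    by_cases hi : i = j
    · subst hi
      by_cases hl : i = l
      · subst hl; simp
      · rw [Matrix.one_apply_ne hl]; simp [Ne.symm hl]
    · by_cases hl : i = l
      · subst hl; simp [hi]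
      · rw [Matrix.one_apply_ne hl]; simp [hi, hl]
  rw [hM, Matrix.vecMulVec_eq (ι := Unit), Matrix.det_one_add_replicateCol_mul_replicateRow]
  simp [dotProduct, Pi.single_apply]

/-- Hence the point-chart matrix has unit determinant. [OURS · elementary] -/
theorem isUnit_det_zMat_pointChartMat (j : Fin (m + 1)) : IsUnit (zMat (pointChartMat m j)).det := by
  rw [det_zMat_pointChartMat]; exact isUnit_one

/-- The cone of the `j`-th point chart: the rows of `pointChartMat j` as rays. [OURS · model object] -/
def pointCone (j : Fin (m + 1)) : Finset (Ray (m + 1)) := Finset.univ.image fun i => rayOf (pointChartMat m j i)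

/-- The cone of the `j`-th point chart is `{𝟙} ∪ {e i | i ≠ j}`. [OURS · elementary] -/
theorem pointCone_eq (j : Fin (m + 1)) :
    pointCone m j = insert 1 ((Finset.univ.image (e (m + 1))).erase (e (m + 1) j)) := by
  classical
  ext ρ
  simp only [pointCone, Finset.mem_image, Finset.mem_univ, true_and, Finset.mem_insert, Finset.mem_erase]
  constructor
  · rintro ⟨i, rfl⟩
    by_cases hi : i = j
    · subst hi; exact Or.inl (rayOf_pointChartMat_self m i)
    · refine Or.inr ⟨?_, i, rayOf_pointChartMat_of_ne m hi |>.symm⟩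
      rw [rayOf_pointChartMat_of_ne m hi]
      intro h
      have := congrFun h i
      simp [e, hi] at this
  · rintro (rfl | ⟨hne, i, rfl⟩)
    · exact ⟨j, rayOf_pointChartMat_self m j⟩
    · have hi : i ≠ j := fun h => hne (h ▸ rfl)
      exact ⟨i, rayOf_pointChartMat_of_ne m hi⟩

/-- The sum of the frame rays is `𝟙`. [OURS · elementary] -/
theorem sum_frame_eq_one : (∑ ρ ∈ Finset.univ.image (e (m + 1)), ρ) = (1 : Ray (m + 1)) := by
  classical
  rw [Finset.sum_image, ← one_eq_sum_e]
  intro i _ l _ h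
  have := congrFun h i
  simpa [e, Pi.single_apply] using this

/-- The point-chart cones are exactly the cones of the point-star of the orthant fan. [OURS · elementary] -/
theorem pointCone_mem_star (j : Fin (m + 1)) :
    pointCone m j ∈ star (orthantFan (m + 1)) (Finset.univ.image (e (m + 1))) := by
  classical
  rw [star, Finset.mem_union]
  refine Or.inr ?_
  rw [Finset.mem_biUnion]
  refine ⟨Finset.univ.image (e (m + 1)), ?_, ?_⟩
  · rw [Finset.mem_filter, orthantFan]; exact ⟨Finset.mem_singleton_self _, subset_rfl⟩
  · rw [Finset.mem_image]
    refine ⟨e (m + 1) j, Finset.mem_image.mpr ⟨j, Finset.mem_univ _, rfl⟩, ?_⟩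
    rw [sum_frame_eq_one, pointCone_eq]

/-- Conversely every cone of the point-star of the orthant fan is a point-chart cone. [OURS · elementary] -/
theorem exists_pointCone_of_mem_star {σ : Finset (Ray (m + 1))} (hσ : σ ∈ star (orthantFan (m + 1)) (Finset.univ.image (e (m + 1)))) :
    ∃ j, σ = pointCone m j := by
  classical
  rw [star, Finset.mem_union, Finset.mem_filter, orthantFan, Finset.mem_singleton] at hσ
  rcases hσ with ⟨rfl, h⟩ | h
  · exact absurd subset_rfl h
  · rw [Finset.mem_biUnion] at h
    obtain ⟨σ₀, hσ₀, hmem⟩ := h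
    rw [Finset.mem_filter, Finset.mem_singleton] at hσ₀
    obtain ⟨rfl, -⟩ := hσ₀
    rw [Finset.mem_image] at hmem
    obtain ⟨t, ht, rfl⟩ := hmem
    obtain ⟨j, -, rfl⟩ := Finset.mem_image.mp ht
    exact ⟨j, by rw [sum_frame_eq_one, pointCone_eq]⟩

/-- The point-chart cones are smooth (unimodular). [OURS · elementary] -/
theorem isSmoothCone_pointCone (j : Fin (m + 1)) : IsSmoothCone (pointCone m j) :=
  ⟨pointChartMat m j, rfl, isUnit_det_zMat_pointChartMat m j⟩

/-- Every cone of the point-star of the orthant fan is smooth. [OURS · elementary] -/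
theorem isSmoothCone_of_mem_star_orthant {σ : Finset (Ray (m + 1))} (hσ : σ ∈ star (orthantFan (m + 1)) (Finset.univ.image (e (m + 1)))) :
    IsSmoothCone σ := by
  obtain ⟨j, rfl⟩ := exists_pointCone_of_mem_star m hσ
  exact isSmoothCone_pointCone m j

end Summit.ResolutionOfSingularities.ResolutionOfSingularities.Cruxes.EquisingularLiftNat.Sections.ND

end
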